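import Mathlib
import Literature.Analysis.Calculus.HadamardLemma
import Summits.AtomisticToContinuum.HydrodynamicLimit.Theorems.ImplosionDichotomyDenseExcursionR2Modes

/-!
# The smooth Euler solver with a negative integer exponent, Hadamard's quotient lemma, smooth cut-offs
# (for theorem T3, existence half; crux `DenseExcursion`, line `sonic-cavity-renewal`, stub `stub_cavityResolventCk`)

Helper file (`--supports stmt-AtomisticToContinuum-12586`, line lead a2, stub-worker E for `stub_cavityResolventCk`,
theorem T3 `centre_regular_branch`, EXISTENCE half: the smooth Fuchsian branch of the resolvent equation at the centre
`R = eˣ → 0`, exponents `0` and `−3`). Generic `C^∞`-category tools (no analyticity at the centre is available):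

* `exists_contDiff_eq_on_Icc` — SMOOTH CUT-OFF: a function `C^n` on `(−δ, δ)` agrees on `[−r, r]` (`r < δ`) with a
  globally `C^n` function (multiply by a `ContDiffBump`);
* `hadamard_quotient` — HADAMARD'S LEMMA in one variable: `φ` smooth with `φ(0) = 0` is `t·ψ(t)` with
  `ψ(t) = ∫₀¹ φ′(st) ds` smooth, `ψ(0) = φ′(0)`;
* THE EULER OPERATOR `(E_m h)(R) = ∫₀¹ t^{m−1} h(Rt) dt` (`m ≥ 1`), the solution of `R·Y′ = −m·Y + h` which is smooth
  at `R = 0` (all other solutions add `c·R^{−m}`): `contDiff_eulerOp` (smooth for smooth `h`, by smooth dependence of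
  integrals on parameters, `Literature.Analysis.Calculus.contDiff_intervalIntegral`), `hasDerivAt_eulerOp`
  (`Y′(R) = ∫₀¹ t^m h′(Rt) dt`), `eulerOp_identity` (`R·Y′ = −m·Y + h`, integration by parts), `norm_eulerOp_le`
  (`‖Y(R)‖ ≤ sup_{|s| ≤ |R|} ‖h‖ / m`), and the LOCAL package `euler_negInt_local` (registered helper): for `h` smooth on
  `(−δ, δ)` only, `E_m h` is smooth on `(−δ, δ)` and satisfies the identity there.

These serve the regular branch at the centre: in the signed radius `R` the resolvent system reads
`R·u_R = a₁₁u + a₁₂c + b₁`, `c_R = a₂₁u + a₂₂c + b₂` with `a₁₁(0) = −3`, solved by `u = E₃[(a₁₁+3)u + a₁₂c + b₁]`,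
`c = c₀ + ∫₀ᴿ(a₂₁u + a₂₂c + b₂)` (contraction, then bootstrap). Sources: folklore (Coddington–Levinson Ch. 4 §2;
Dieudonné (8.11.2)).
-/

noncomputable section

open Set Filter MeasureTheory intervalIntegral
open scoped Topology ContDiff

namespace Summit.AtomisticToContinuum.HydrodynamicLimit.Theorems.SonicCavityRenewal

/-! ## Smooth cut-off -/

/-- SMOOTH CUT-OFF: a function of class `C^n` on `(−δ, δ)` coincides on `[−r, r]`, `0 < r < δ`, with a globally `C^n`
function (multiply by a smooth bump equal to `1` on `[−r, r]` and supported in `(−δ, δ)`). [folklore] -/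
theorem exists_contDiff_eq_on_Icc {F : Type*} [NormedAddCommGroup F] [NormedSpace ℝ F] {n : ℕ∞} {h : ℝ → F}
    {δ r : ℝ} (hr : 0 < r) (hrδ : r < δ) (hh : ContDiffOn ℝ n h (Ioo (-δ) δ)) :
    ∃ g : ℝ → F, ContDiff ℝ n g ∧ EqOn g h (Icc (-r) r) := by
  let χ : ContDiffBump (0 : ℝ) := ⟨r, (r + δ) / 2, hr, by linarith⟩
  refine ⟨fun x => χ x • h x, contDiff_iff_contDiffAt.2 fun x => ?_, fun x hx => ?_⟩
  · by_cases hxδ : |x| < δ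
    · have hx : x ∈ Ioo (-δ) δ := by rw [mem_Ioo, ← abs_lt]; exact hxδ
      exact χ.contDiff.contDiffAt.smul (hh.contDiffAt (isOpen_Ioo.mem_nhds hx))
    · -- `χ = 0` near `x`
      have hfar : ∀ᶠ y in 𝓝 x, χ y • h y = 0 := by
        have hopen : IsOpen {y : ℝ | (r + δ) / 2 < dist y 0} := isOpen_lt continuous_const (continuous_id.dist continuous_const)
        have hxmem : x ∈ {y : ℝ | (r + δ) / 2 < dist y 0} := by
          show (r + δ) / 2 < dist x 0
          rw [Real.dist_eq, sub_zero]; linarith [not_lt.1 hxδ]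
        filter_upwards [hopen.mem_nhds hxmem] with y hy
        rw [χ.zero_of_le_dist (le_of_lt hy), zero_smul]
      exact (contDiffAt_const (c := (0 : F))).congr_of_eventuallyEq (hfar.mono fun y hy => hy)
  · have hx' : x ∈ Metric.closedBall (0 : ℝ) χ.rIn := by
      rw [Metric.mem_closedBall, Real.dist_eq, sub_zero]; exact abs_le.2 hx
    simp only [χ.one_of_mem_closedBall hx', one_smul]

/-! ## Hadamard's quotient lemma -/

/-- **HADAMARD'S LEMMA** (one variable): if `φ` is smooth with `φ 0 = 0` then `φ t = t·ψ t` with `ψ` smooth,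
`ψ t = ∫₀¹ φ′(st) ds`, `ψ 0 = φ′(0)`. [folklore] -/
theorem hadamard_quotient {φ : ℝ → ℂ} (hφ : ContDiff ℝ ∞ φ) (h0 : φ 0 = 0) :
    ∃ ψ : ℝ → ℂ, ContDiff ℝ ∞ ψ ∧ (∀ t, φ t = t * ψ t) ∧ ψ 0 = deriv φ 0 := by
  have hφ' : ContDiff ℝ ∞ (deriv φ) := (contDiff_infty_iff_deriv.1 hφ).2
  refine ⟨fun t => ∫ s in (0 : ℝ)..1, deriv φ (t * s), ?_, fun t => ?_, by simp⟩
  · have hF : ContDiff ℝ (⊤ : ℕ∞) (Function.uncurry fun (t s : ℝ) => deriv φ (t * s)) :=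
      hφ'.comp (contDiff_fst.mul contDiff_snd)
    exact Literature.Analysis.Calculus.contDiff_intervalIntegral hF 0 1
  · rcases eq_or_ne t 0 with rfl | ht
    · simp [h0]
    · have hsub : (∫ s in (0 : ℝ)..1, deriv φ (t * s)) = t⁻¹ • ∫ s in (0 : ℝ)..t, deriv φ s := by
        have h := intervalIntegral.integral_comp_mul_left (fun s => deriv φ s) (a := 0) (b := 1) ht
        simpa using h
      have hFTC : (∫ s in (0 : ℝ)..t, deriv φ s) = φ t - φ 0 :=
        integral_deriv_eq_sub (fun s _ => hφ.differentiable (by simp) s) (hφ'.continuous.intervalIntegrable _ _)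
      show φ t = t * ∫ s in (0 : ℝ)..1, deriv φ (t * s)
      rw [hsub, hFTC, h0, sub_zero, Complex.real_smul]
      have htc : (t : ℂ) ≠ 0 := Complex.ofReal_ne_zero.2 ht
      push_cast
      field_simp

/-! ## The Euler operator with exponent `−m` -/

/-- The integrand `(R, t) ↦ t^k · h(Rt)` of the Euler operator is jointly smooth for smooth `h`. [folklore] -/
theorem contDiff_euler_integrand {n : ℕ∞} (k : ℕ) {h : ℝ → ℂ} (hh : ContDiff ℝ n h) :
    ContDiff ℝ n (Function.uncurry fun (R t : ℝ) => (t : ℂ) ^ k * h (R * t)) :=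
  ((Complex.ofRealCLM.contDiff.comp contDiff_snd).pow k).mul (hh.comp (contDiff_fst.mul contDiff_snd))

/-- SMOOTHNESS OF THE EULER OPERATOR: for `h` of class `C^n` on `ℝ`, `R ↦ ∫₀¹ t^k h(Rt) dt` is `C^n` (smooth dependence
of integrals on parameters). [folklore] -/
theorem contDiff_eulerOp {n : ℕ∞} (k : ℕ) {h : ℝ → ℂ} (hh : ContDiff ℝ n h) :
    ContDiff ℝ n (fun R => ∫ t in (0 : ℝ)..1, (t : ℂ) ^ k * h (R * t)) :=
  Literature.Analysis.Calculus.contDiff_intervalIntegral (contDiff_euler_integrand k hh) 0 1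

/-- THE DERIVATIVE OF THE EULER OPERATOR: for smooth `h`, `d/dR ∫₀¹ t^k h(Rt) dt = ∫₀¹ t^{k+1} h′(Rt) dt`
(differentiation under the integral sign). [folklore] -/
theorem hasDerivAt_eulerOp (k : ℕ) {h : ℝ → ℂ} (hh : ContDiff ℝ ∞ h) (R : ℝ) :
    HasDerivAt (fun R => ∫ t in (0 : ℝ)..1, (t : ℂ) ^ k * h (R * t))
      (∫ t in (0 : ℝ)..1, (t : ℂ) ^ (k + 1) * deriv h (R * t)) R := by
  have hF := contDiff_euler_integrand k hh
  have h1 := (Literature.Analysis.Calculus.hasFDerivAt_intervalIntegral_partialFDerivFst hF (by simp) 0 1 R).hasDerivAt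
  have happly : (∫ t in (0 : ℝ)..1, Literature.Analysis.Calculus.partialFDerivFst
      (fun (R t : ℝ) => (t : ℂ) ^ k * h (R * t)) R t) (1 : ℝ) =
      ∫ t in (0 : ℝ)..1, Literature.Analysis.Calculus.partialFDerivFst (fun (R t : ℝ) => (t : ℂ) ^ k * h (R * t)) R t 1 :=
    ContinuousLinearMap.intervalIntegral_apply
      (((Literature.Analysis.Calculus.continuous_uncurry_partialFDerivFst hF (by simp)).comp
        (Continuous.prodMk_right R)).intervalIntegrable _ _) 1
  rw [happly] at h1
  refine h1.congr_deriv (integral_congr fun t _ => ?_)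
  -- identify `∂_R (t^k h(Rt)) = t^{k+1} h′(Rt)`
  have hpt : HasDerivAt (fun R : ℝ => (t : ℂ) ^ k * h (R * t)) ((t : ℂ) ^ k * ((t : ℝ) • deriv h (R * t))) R := by
    have hc : HasDerivAt (fun R : ℝ => h (R * t)) ((t : ℝ) • deriv h (R * t)) R :=
      ((hh.differentiable (by simp)) (R * t)).hasDerivAt.scomp R (hasDerivAt_mul_const t)
    exact hc.const_mul _
  have hpf := (Literature.Analysis.Calculus.hasFDerivAt_partialFDerivFst
    ((hF.differentiable (by simp)).differentiableAt (x := (R, t)))).hasDerivAt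
  rw [hpf.unique hpt, Complex.real_smul]
  ring

/-- THE EULER IDENTITY: for smooth `h` and `m ≥ 1`, `Y(R) = ∫₀¹ t^{m−1} h(Rt) dt` satisfies `R·Y′(R) = −m·Y(R) + h(R)`
for EVERY `R` (integration by parts of `d/dt (t^m h(Rt)) = m t^{m−1} h(Rt) + t^m R h′(Rt)` on `[0, 1]`). [folklore] -/
theorem eulerOp_identity (m : ℕ) (hm : 1 ≤ m) {h : ℝ → ℂ} (hh : ContDiff ℝ ∞ h) (R : ℝ) :
    (R : ℂ) * deriv (fun R => ∫ t in (0 : ℝ)..1, (t : ℂ) ^ (m - 1) * h (R * t)) R =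
      -(m : ℂ) * (∫ t in (0 : ℝ)..1, (t : ℂ) ^ (m - 1) * h (R * t)) + h R := by
  obtain ⟨k, rfl⟩ : ∃ k, m = k + 1 := ⟨m - 1, by omega⟩
  simp only [Nat.add_sub_cancel]
  rw [(hasDerivAt_eulerOp k hh R).deriv]
  -- integration by parts
  set G : ℝ → ℂ := fun t => (t : ℂ) ^ (k + 1) * h (R * t) with hG
  set G' : ℝ → ℂ := fun t => ((k + 1 : ℕ) : ℂ) * ((t : ℂ) ^ k * h (R * t)) + (R : ℂ) * ((t : ℂ) ^ (k + 1) * deriv h (R * t))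
    with hG'
  have hGd : ∀ t, HasDerivAt G (G' t) t := by
    intro t
    have h1 : HasDerivAt (fun t : ℝ => (t : ℂ) ^ (k + 1)) (((k + 1 : ℕ) : ℂ) * (t : ℂ) ^ k) t := by
      simpa using (hasDerivAt_pow (k + 1) (t : ℂ)).comp_ofReal
    have h2 : HasDerivAt (fun t : ℝ => h (R * t)) ((R : ℝ) • deriv h (R * t)) t :=
      ((hh.differentiable (by simp)) (R * t)).hasDerivAt.scomp t (hasDerivAt_const_mul R)
    refine (h1.mul h2).congr_deriv ?_
    simp only [hG', Complex.real_smul]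
    ring
  have hcont1 : Continuous fun t : ℝ => (t : ℂ) ^ k * h (R * t) :=
    ((Complex.continuous_ofReal.pow k)).mul (hh.continuous.comp (continuous_const.mul continuous_id))
  have hcont2 : Continuous fun t : ℝ => (t : ℂ) ^ (k + 1) * deriv h (R * t) :=
    ((Complex.continuous_ofReal.pow (k + 1))).mul
      ((hh.continuous_deriv (by simp)).comp (continuous_const.mul continuous_id))
  have hint1 : IntervalIntegrable (fun t : ℝ => (t : ℂ) ^ k * h (R * t)) volume 0 1 := hcont1.intervalIntegrable _ _
  have hint2 : IntervalIntegrable (fun t : ℝ => (t : ℂ) ^ (k + 1) * deriv h (R * t)) volume 0 1 :=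
    hcont2.intervalIntegrable _ _
  have hFTC := integral_eq_sub_of_hasDerivAt (fun t _ => hGd t) ((hint1.const_mul _).add (hint2.const_mul _))
  have hsplit : (∫ t in (0 : ℝ)..1, G' t) = ((k + 1 : ℕ) : ℂ) * (∫ t in (0 : ℝ)..1, (t : ℂ) ^ k * h (R * t)) +
      (R : ℂ) * ∫ t in (0 : ℝ)..1, (t : ℂ) ^ (k + 1) * deriv h (R * t) := by
    simp only [hG']
    rw [integral_add (hint1.const_mul _) (hint2.const_mul _), intervalIntegral.integral_const_mul,
      intervalIntegral.integral_const_mul]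
  have hG1 : G 1 = h R := by simp [hG]
  have hG0 : G 0 = 0 := by simp [hG]
  rw [hsplit, hG1, hG0, sub_zero] at hFTC
  linear_combination hFTC

/-- THE VALUE AT THE ORIGIN: `(E_m h)(0) = h(0)/m`, i.e. `m·Y(0) = h(0)`. [folklore] -/
theorem eulerOp_zero (m : ℕ) (hm : 1 ≤ m) (h : ℝ → ℂ) :
    (m : ℂ) * (∫ t in (0 : ℝ)..1, (t : ℂ) ^ (m - 1) * h (0 * t)) = h 0 := by
  obtain ⟨k, rfl⟩ : ∃ k, m = k + 1 := ⟨m - 1, by omega⟩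
  have hpow : (∫ t in (0 : ℝ)..1, (t : ℂ) ^ k) = ((k : ℂ) + 1)⁻¹ := by
    have h1 : (∫ t in (0 : ℝ)..1, (t : ℂ) ^ k) = (((∫ t in (0 : ℝ)..1, t ^ k : ℝ)) : ℂ) := by
      rw [← intervalIntegral.integral_ofReal]; push_cast; rfl
    rw [h1, integral_pow]
    push_cast
    ring
  simp only [Nat.add_sub_cancel, zero_mul]
  rw [intervalIntegral.integral_mul_const, hpow]
  push_cast
  field_simp

/-- THE SUP BOUND OF THE EULER OPERATOR: if `‖h s‖ ≤ C` for `|s| ≤ |R|` then `‖(E_m h)(R)‖ ≤ C/m`. [folklore] -/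
theorem norm_eulerOp_le (m : ℕ) (hm : 1 ≤ m) {h : ℝ → ℂ} {R C : ℝ} (hC : ∀ s, |s| ≤ |R| → ‖h s‖ ≤ C) :
    ‖∫ t in (0 : ℝ)..1, (t : ℂ) ^ (m - 1) * h (R * t)‖ ≤ C / m := by
  obtain ⟨k, rfl⟩ : ∃ k, m = k + 1 := ⟨m - 1, by omega⟩
  simp only [Nat.add_sub_cancel]
  have hC0 : 0 ≤ C := (norm_nonneg _).trans (hC 0 (by simp))
  have hb : ∀ᵐ t ∂volume, t ∈ Set.Ioc (0 : ℝ) 1 → ‖(t : ℂ) ^ k * h (R * t)‖ ≤ C * t ^ k := by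
    refine ae_of_all _ fun t ht => ?_
    rw [norm_mul, norm_pow, Complex.norm_real, Real.norm_of_nonneg ht.1.le, mul_comm]
    refine mul_le_mul_of_nonneg_right (hC _ ?_) (pow_nonneg ht.1.le k)
    rw [abs_mul, abs_of_pos ht.1]
    exact mul_le_of_le_one_right (abs_nonneg R) ht.2
  calc ‖∫ t in (0 : ℝ)..1, (t : ℂ) ^ k * h (R * t)‖ ≤ ∫ t in (0 : ℝ)..1, C * t ^ k :=
        norm_integral_le_of_norm_le zero_le_one hb ((continuous_const.mul (continuous_pow k)).intervalIntegrable _ _)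
    _ = C / (k + 1 : ℕ) := by
        rw [intervalIntegral.integral_const_mul, integral_pow]; push_cast; field_simp; ring

/-- **Registered helper `euler_negInt_local`: THE LOCAL EULER PACKAGE.** For `m ≥ 1`, `δ > 0` and `h` of class `C^∞`
on `(−δ, δ)`, `Y(R) = ∫₀¹ t^{m−1} h(Rt) dt` is of class `C^∞` on `(−δ, δ)` and `R·Y′(R) = −m·Y(R) + h(R)` there (cut `h`
off smoothly outside `[−r, r] ∋ R` and use the global statements; the integral only sees `h` on `[−|R|, |R|]`).
[folklore] -/
theorem euler_negInt_local : ∀ (m : ℕ) (δ : ℝ) (h : ℝ → ℂ), 1 ≤ m → 0 < δ → ContDiffOn ℝ ∞ h (Set.Ioo (-δ) δ) → ContDiffOn ℝ ∞ (fun R => ∫ t in (0 : ℝ)..1, (t : ℂ) ^ (m - 1) * h (R * t)) (Set.Ioo (-δ) δ) ∧ ∀ R ∈ Set.Ioo (-δ) δ, (R : ℂ) * deriv (fun R => ∫ t in (0 : ℝ)..1, (t : ℂ) ^ (m - 1) * h (R * t)) R = -(m : ℂ) * (∫ t in (0 : ℝ)..1, (t : ℂ) ^ (m - 1) * h (R *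 t)) + h R := by
  intro m δ h hm hδ hh
  -- for every `R₀ ∈ (−δ, δ)`: a radius `r` with `|R₀| < r < δ`, a global smooth `g = h` on `[−r, r]`, and the two Euler
  -- integrals agree on the neighbourhood `(−r, r)` of `R₀`
  have loc : ∀ R₀ ∈ Ioo (-δ) δ, ∃ r, |R₀| < r ∧ r < δ ∧ ∃ g : ℝ → ℂ, ContDiff ℝ ∞ g ∧ EqOn g h (Icc (-r) r) ∧
      (fun R => ∫ t in (0 : ℝ)..1, (t : ℂ) ^ (m - 1) * h (R * t)) =ᶠ[𝓝 R₀]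
        fun R => ∫ t in (0 : ℝ)..1, (t : ℂ) ^ (m - 1) * g (R * t) := by
    intro R₀ hR₀
    have hR₀' : |R₀| < δ := abs_lt.2 hR₀
    set r : ℝ := (|R₀| + δ) / 2 with hr
    have h1 : |R₀| < r := by rw [hr]; linarith
    have h2 : r < δ := by rw [hr]; linarith
    have hr0 : 0 < r := lt_of_le_of_lt (abs_nonneg _) h1
    obtain ⟨g, hg, hgh⟩ := exists_contDiff_eq_on_Icc (n := ⊤) hr0 h2 hh
    refine ⟨r, h1, h2, g, hg, hgh, ?_⟩
    have hnhds : Ioo (-r) r ∈ 𝓝 R₀ := isOpen_Ioo.mem_nhds (by rw [mem_Ioo, ← abs_lt]; exact h1)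
    filter_upwards [hnhds] with R hR
    refine integral_congr fun t ht => ?_
    rw [uIcc_of_le zero_le_one] at ht
    have hRt : R * t ∈ Icc (-r) r := by
      have hR' : |R| < r := abs_lt.2 hR
      have : |R * t| ≤ |R| := by
        rw [abs_mul, abs_of_nonneg ht.1]; exact mul_le_of_le_one_right (abs_nonneg R) ht.2
      constructor <;> linarith [(abs_le.1 (this.trans hR'.le)).1, (abs_le.1 (this.trans hR'.le)).2]
    simp only [hgh hRt]
  refine ⟨fun R₀ hR₀ => ?_, fun R₀ hR₀ => ?_⟩
  · obtain ⟨r, -, -, g, hg, -, hev⟩ := loc R₀ hR₀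
    exact ((contDiff_eulerOp (m - 1) hg).contDiffAt.congr_of_eventuallyEq hev).contDiffWithinAt
  · obtain ⟨r, h1, -, g, hg, hgh, hev⟩ := loc R₀ hR₀
    have hR₀r : R₀ ∈ Icc (-r) r := ⟨by linarith [(abs_lt.1 h1).1], by linarith [(abs_lt.1 h1).2]⟩
    rw [hev.deriv_eq, hev.eq_of_nhds, ← hgh hR₀r]
    exact eulerOp_identity m hm hg R₀

end Summit.AtomisticToContinuum.HydrodynamicLimit.Theorems.SonicCavityRenewal

end
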